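import Mathlib
import Summits.ValiantsHypothesis.ValiantsHypothesis.Theorems.LacunarySymmetroidMatrixDescartesCensusDefs
import Summits.ValiantsHypothesis.ValiantsHypothesis.Theorems.KPlusLogSqLawWeakLiftingTowerGraftRankOneGraft

/-!
# Tower graft line — THE PROBE DICTIONARY: every crossing of the corner graft is a root of an in-class rank-one probe

Mechanism file for the line `Cruxes/WeakLifting/Lines/tower_graft.lean` (crux `WeakLifting` = stmt-ValiantsHypothesis-19561; letters spine,
S4b `stub_graftLawCorner` at LINEAR steepness).  NO stub is claimed.  It types §2 (a)+(b) of the seat's memo `PROBE-T1-liftp3g18.md` (evidence on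
19561; planner val-idea-24 g0 ruling 2026-08-28T20:56:34Z (3): «only (a) + (b)»).

The corner graft of a symmetric `(m+1)`-pencil `G = ∑ X^{dₗ} • Sₗ` is `h = det (G + X^D • E₀₀) = det G + X^D · det G₀₀` (tree
`det_add_smul_single_zero`, p652288).  A RANK-ONE PROBE is the pencil obtained by perturbing ONE letter in the graft direction,
`Sₗ₀ ↦ Sₗ₀ + c·E₀₀` (`c : ℝ`); it is again a symmetric pencil of size `m+1` on the SAME support, with determinant
`det G + c·X^{d_{l₀}}·det G₀₀` (`det_probePencil`), hence (b) `card_posRoots_probe_le`: `Z₊(det G + c·X^{d_{l₀}}·det G₀₀) ≤ B` under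
`PosRootLawOn (m+1) K B d`.  (a) `graft_isRoot_iff_probe_isRoot`: a real `t` is a root of `A + X^D E` iff it is a root of the probe polynomial
`A + c·X^{dₗ}·E` with `c = t^{D−dₗ}` (`dₗ ≤ D`) — every crossing of the steep arc IS a root of an in-class probe, the probe LEVEL `c = t^{D−dₗ}`
increasing strictly with the crossing; conversely a probe of level `c > 0` contains at most the one crossing `t = c^{1/(D−dₗ)}`
(`probe_level_unique`).  So the content of any probe-shaped law (PROBE-T1 / the SHADOW BOUND of the memos) is numerical sharing of probe
roots NEAR neighbouring crossings, never literal containment.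

Def-free; Mathlib + `…CensusDefs` + `…TowerGraftRankOneGraft`.  HONEST FRAMING: a dictionary (three identities and one class reading); nothing on
S4b/S5, TowerB, `WeakLifting`, Conjecture B, 18050 or `VP ≠ VNP`.  Seat: prover val-sym-lift-p3 g18, `--supports stmt-ValiantsHypothesis-19561`.
-/

-- `Summit.ValiantsHypothesis.ValiantsHypothesis.…` repeats a component by the D-0017 layout
-- (single-conjunct summit), which the `dupNamespace` linter flags; the name is mandated.
set_option linter.dupNamespace false

namespace Summit.ValiantsHypothesis.ValiantsHypothesis.Theorems.KPlusLogSqLaw.TowerGraft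

open Finset Polynomial Matrix
open scoped BigOperators Polynomial
open Summit.ValiantsHypothesis.ValiantsHypothesis.Theorems.LacunarySymmetroidMatrixDescartes (PosRootLawOn)

/-! ## (a) every crossing of the steep arc is a root of the probe at level `c = t^{D−dₗ}` -/

/-- **graft root ⇔ probe root**: `A(t) + t^D E(t) = 0 ↔ A(t) + t^{D−dₗ}·t^{dₗ}·E(t) = 0` (`dₗ ≤ D`), i.e. `t` is a root of `A + X^D E` iff it is a
root of the probe polynomial `A + C (t^{D−dₗ}) · X^{dₗ} · E`. [folklore] -/
theorem graft_isRoot_iff_probe_isRoot (A E : ℝ[X]) {D dl : ℕ} (hdl : dl ≤ D) (t : ℝ) :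
    (A + (X : ℝ[X]) ^ D * E).IsRoot t ↔ (A + Polynomial.C (t ^ (D - dl)) * (X : ℝ[X]) ^ dl * E).IsRoot t := by
  simp only [Polynomial.IsRoot, Polynomial.eval_add, Polynomial.eval_mul, Polynomial.eval_pow, Polynomial.eval_X, Polynomial.eval_C]
  rw [← pow_add, Nat.sub_add_cancel hdl]

/-- a probe of positive level `c` meets the steep arc in at most ONE point: if two positive reals `t, t'` both have probe level `c`
(`t^{D−dₗ} = c = t'^{D−dₗ}`, `dₗ < D`) then `t = t'`. [folklore] -/
theorem probe_level_unique {D dl : ℕ} (hdl : dl < D) {t t' : ℝ} (ht : 0 < t) (ht' : 0 < t')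
    (h : t ^ (D - dl) = t' ^ (D - dl)) : t = t' := by
  have hn : D - dl ≠ 0 := by omega
  exact (pow_left_inj₀ ht.le ht'.le hn).mp h

/-! ## (b) the rank-one probe is a class pencil on the same support -/

variable {m K : ℕ}

/-- the probe letters: `Sₗ₀ ↦ Sₗ₀ + c·E₀₀`, all other letters unchanged. -/
theorem probePencil_eq (d : Fin K → ℕ) (S : Fin K → Matrix (Fin (m + 1)) (Fin (m + 1)) ℝ) (l₀ : Fin K) (c : ℝ) :
    (∑ l, ((X : ℝ[X]) ^ d l) • (S l + if l = l₀ then c • Matrix.single (0 : Fin (m + 1)) (0 : Fin (m + 1)) (1 : ℝ) else 0).map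
        Polynomial.C) =
      (∑ l, ((X : ℝ[X]) ^ d l) • (S l).map Polynomial.C) +
        (Polynomial.C c * (X : ℝ[X]) ^ d l₀) • Matrix.single (0 : Fin (m + 1)) (0 : Fin (m + 1)) (1 : ℝ[X]) := by
  have hsplit : ∀ l, ((X : ℝ[X]) ^ d l) • (S l + if l = l₀ then c • Matrix.single (0 : Fin (m + 1)) (0 : Fin (m + 1)) (1 : ℝ)
      else 0).map Polynomial.C = ((X : ℝ[X]) ^ d l) • (S l).map Polynomial.C +
        (if l = l₀ then (Polynomial.C c * (X : ℝ[X]) ^ d l) • Matrix.single (0 : Fin (m + 1)) (0 : Fin (m + 1)) (1 : ℝ[X])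
          else 0) := by
    intro l
    split_ifs with hl
    · rw [Matrix.map_add Polynomial.C (fun a b => map_add Polynomial.C a b), smul_add]
      congr 1
      refine Matrix.ext fun i j => ?_
      simp only [Matrix.smul_apply, Matrix.map_apply, Matrix.single, Matrix.of_apply, smul_eq_mul]
      split_ifs
      · rw [mul_one, mul_one, mul_comm]
      · rw [mul_zero, map_zero, mul_zero, mul_zero]
    · rw [add_zero, add_zero]
  simp_rw [hsplit, Finset.sum_add_distrib, Finset.sum_ite_eq' Finset.univ l₀, if_pos (Finset.mem_univ _)]

/-- the probe letters are symmetric when the letters are. [folklore] -/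
theorem isSymm_probeLetter {S : Matrix (Fin (m + 1)) (Fin (m + 1)) ℝ} (hS : S.IsSymm) (l l₀ : Fin K) (c : ℝ) :
    (S + if l = l₀ then c • Matrix.single (0 : Fin (m + 1)) (0 : Fin (m + 1)) (1 : ℝ) else 0).IsSymm := by
  split_ifs
  · have h1 : (Matrix.single (0 : Fin (m + 1)) (0 : Fin (m + 1)) (1 : ℝ)).IsSymm :=
      Matrix.IsSymm.ext fun a b => by simp [Matrix.single, and_comm]
    exact hS.add (h1.smul c)
  · rw [add_zero]; exact hS

/-- **the determinant of the rank-one probe**: `det (∑ X^{dₗ} • (Sₗ + [l = l₀] c E₀₀)) = det G + c·X^{d_{l₀}}·det G₀₀`. [folklore] -/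
theorem det_probePencil (d : Fin K → ℕ) (S : Fin K → Matrix (Fin (m + 1)) (Fin (m + 1)) ℝ) (l₀ : Fin K) (c : ℝ) :
    (∑ l, ((X : ℝ[X]) ^ d l) • (S l + if l = l₀ then c • Matrix.single (0 : Fin (m + 1)) (0 : Fin (m + 1)) (1 : ℝ) else 0).map
        Polynomial.C).det =
      (∑ l, ((X : ℝ[X]) ^ d l) • (S l).map Polynomial.C).det +
        Polynomial.C c * (X : ℝ[X]) ^ d l₀ * (∑ l, ((X : ℝ[X]) ^ d l) • ((S l).submatrix Fin.succ Fin.succ).map Polynomial.C).det := by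
  rw [probePencil_eq, det_add_smul_single_zero]
  congr 2
  refine congr_arg Matrix.det (Matrix.ext fun i j => ?_)
  simp [Matrix.submatrix_apply, Matrix.sum_apply, Matrix.smul_apply, Matrix.map_apply]

/-- **(b) THE RANK-ONE PROBE OBEYS THE CLASS LAW**: `Z₊(det G + c·X^{d_{l₀}}·det G₀₀) ≤ B` for every real `c` and every letter index `l₀`,
whenever `PosRootLawOn (m+1) K B d` — the probe is a symmetric `(m+1)`-pencil on the same support. [this work] -/
theorem card_posRoots_probe_le {B : ℕ} {d : Fin K → ℕ} (hB : PosRootLawOn (m + 1) K B d)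
    (S : Fin K → Matrix (Fin (m + 1)) (Fin (m + 1)) ℝ) (hS : ∀ l, (S l).IsSymm) (l₀ : Fin K) (c : ℝ) :
    (((∑ l, ((X : ℝ[X]) ^ d l) • (S l).map Polynomial.C).det +
        Polynomial.C c * (X : ℝ[X]) ^ d l₀ *
          (∑ l, ((X : ℝ[X]) ^ d l) • ((S l).submatrix Fin.succ Fin.succ).map Polynomial.C).det).roots.toFinset.filter
      (fun t => 0 < t)).card ≤ B := by
  rw [← det_probePencil]
  exact hB _ (fun l => isSymm_probeLetter (hS l) l l₀ c)

/-- **(a) in class currency**: every positive root `t` of the corner graft `det G + X^D · det G₀₀` is a positive root of the in-class probe of level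
`c = t^{D − d_{l₀}}` (any `l₀` with `d_{l₀} ≤ D`). [this work] -/
theorem graft_root_mem_probe_roots (d : Fin K → ℕ) (S : Fin K → Matrix (Fin (m + 1)) (Fin (m + 1)) ℝ) {D : ℕ} (l₀ : Fin K)
    (hdl : d l₀ ≤ D) {t : ℝ}
    (ht : ((∑ l, ((X : ℝ[X]) ^ d l) • (S l).map Polynomial.C).det +
      (X : ℝ[X]) ^ D * (∑ l, ((X : ℝ[X]) ^ d l) • ((S l).submatrix Fin.succ Fin.succ).map Polynomial.C).det).IsRoot t) :
    ((∑ l, ((X : ℝ[X]) ^ d l) • (S l).map Polynomial.C).det +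
      Polynomial.C (t ^ (D - d l₀)) * (X : ℝ[X]) ^ d l₀ *
        (∑ l, ((X : ℝ[X]) ^ d l) • ((S l).submatrix Fin.succ Fin.succ).map Polynomial.C).det).IsRoot t :=
  (graft_isRoot_iff_probe_isRoot _ _ hdl t).mp ht

end Summit.ValiantsHypothesis.ValiantsHypothesis.Theorems.KPlusLogSqLaw.TowerGraft
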